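import Summits.BirchSwinnertonDyer.Rank1Residual.X11b.KummerRelaxationIndexExact
import Summits.BirchSwinnertonDyer.Rank1Residual.X11b.LocalPrimaryCohomologyEP
import Summits.BirchSwinnertonDyer.BirchSwinnertonDyer.Theorems.SchneiderFreeAdditiveX3PoitouTateSelmerDualityHolds
import Literature.NumberTheory.GaloisRepresentations.ContinuousH1OrderTwo
import HarnessLib

set_option linter.dupNamespace false -- `…BirchSwinnertonDyer.BirchSwinnertonDyer…` is the cell's nested layout (D-0017)
set_option autoImplicit false

/-!
# Cassels' theorem with rational `p`-torsion, finite level: the EXACT RELAXATION INDEX at one finite place for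
# ODD `p` over ANY number field (real places allowed) — `[H¹_{𝓛, ⊤ at 𝔮}(K, E[p^k]) : Sel_{p^k}(E/K)] · #loc_𝔮 Sel_{p^k}
# = #𝓛_𝔮`, UNCONDITIONAL (Greenberg LNM 1716 §4 Appendix Prop. 4.13, finite-level body)

Seat `bsd-inputs-k4-p1` (gen 7; LADDER-BSD D-0154 KEY (147)(f) «prove the printed input», row 1 K4 INPUTS; Greenberg
1999), `--supports stmt-BirchSwinnertonDyer-20309`. THEOREMS ONLY (no definition, no named fact, no `sorry`).

R. Greenberg, *Iwasawa theory for elliptic curves*, LNM 1716 (1999), §4 p. 104 and Appendix Prop. 4.13 (pp. 121–122):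
"a theorem of Cassels which states that `𝒫_E^Σ(F)/𝒢_E^Σ(F) ≅ E(F)_p^∧`" — the cokernel of the global-to-local map
`H¹(F_Σ/F, E[p^∞]) → ∏_{v∈Σ} H¹(F_v, E[p^∞])/Im κ_v` is dual to the `p`-adic completion of `E(F)`. Its finite-level
body is the EXACT index of the Selmer group inside the Selmer group RELAXED at one finite place `𝔮`: the cell
`b2b-bsdres` proved (`X11b.KummerPT.relIndex_selmerGroup_kummerOutside_mul_natCard_map_eq`, JSW17 Prop. 3.2.1 at finite
level) `[kummerOutside W (p^k) {𝔮} : Sel_{p^k}] · #loc_𝔮(Sel_{p^k}) = #𝓛_𝔮` for number fields ALL OF WHOSE INFINITE PLACES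
ARE COMPLEX — which excludes `ℚ`, the habitat of Theorem 4.1. The hypothesis enters at exactly one point: the Weil
transport of a dual Selmer class must satisfy the Kummer condition at the infinite places, vacuous at a complex place.
For ODD `p` it is vacuous at EVERY infinite place (`H¹(K_w, M) = 0` for an odd-torsion `M`, tree theorem
`eq_zero_of_odd_nsmul_galoisCohomology_one_toLocal_inl`), so the whole chain ports to any number field:

* §1 `map_weilDualInv_mem_kummerOutside_of_mem_dualSelmerGroup_of_odd`, `exists_mem_kummerOutside_localization_eq_of_odd`
  — the X11b Poitou–Tate exactness for the Kummer structure (Howard 2.1.11 `SelmerComplement` + Weil transport) with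
  «all infinite places complex» replaced by «`n` odd»;
* §2 `forall_mem_map_kummerOutside_iff_of_odd` (`loc_𝔮 H¹_{𝓛, ⊤ at 𝔮}` is its own annihilator), `annLeft_inf_eq_sup_of_odd`
  (Milne I Lemma 6.15), **`relIndex_selmerGroup_kummerOutside_mul_natCard_map_eq_of_odd`** —
  `[kummerOutside W (p^k) {𝔮} : Sel_{p^k}(E/K)] · #loc_𝔮(Sel_{p^k}(E/K)) = #𝓛_𝔮` for a Poitou–Tate family;
* §3 **`relIndex_selmerGroup_kummerOutside_mul_natCard_map_eq_odd`** — the same UNCONDITIONALLY for every number field `K`,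
  odd prime `p`, `k ≥ 1`, finite place `𝔮`, right side `#E(K_𝔮)[p^k] · #(𝓞_𝔮/p^k)`: the Poitou–Tate family is
  `SchneiderFreeAdditiveX3.PoitouTateReduction.poitouTate_selmerStructure_duality_holds K`, Tate's count is
  `natCard_galoisCohomology_one_torsion_adicCompletion_eq_sqEP`. Equivalently (Tate: `#H¹(K_𝔮, E[p^k]) = #𝓛_𝔮²`) the
  cokernel of `H¹_{𝓛, ⊤ at 𝔮}(K, E[p^k]) → H¹(K_𝔮, E[p^k])/𝓛_𝔮 = H¹(K_𝔮, E)[p^k]` has order `#loc_𝔮(Sel_{p^k}(E/K))` — the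
  finite-level form of Cassels' cokernel; with `Sel_{p^∞}(E/K)` finite and `𝔮 ∤ p`, `loc_𝔮(Sel_{p^k}) ≅ E(K)[p^∞]` at
  deep level (sequel), whence `#(𝒫^Σ(K)/𝒢^Σ(K)) = #E(K)[p^∞]` with rational torsion ALLOWED.

HONEST FRAMING: a port («totally complex» ↦ «`p` odd») of cell b2b-bsdres's X11b theorems plus the two discharged facts;
`p = 2` (real places, Greenberg p. 106) is NOT treated; closes no item; no summit statement is proved; BSD is not proved.
References: [GreenbergLNM1716] §4 p. 104, Prop. 4.13 (pp. 121–123); [MilneADT2006] I Cor. 2.3, Thm. 2.8, Thm. 4.10 (b),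
Lemma 6.15, Prop. 6.9; [Howard2004HeegnerKolyvagin] Thm. 2.1.11; [JetchevSkinnerWan2017] Prop. 3.2.1; [SerreGaloisCohomology1997] I §2.4.
-/

noncomputable section

open scoped Classical

open CategoryTheory Field NumberField IsDedekindDomain Function
open Literature.NumberTheory.EllipticCurves Literature.NumberTheory.EllipticCurves.GreenbergSelmer
open Literature.NumberTheory.GaloisRepresentations
open Literature.NumberTheory.GaloisRepresentations.DiscreteGaloisModule (SelmerStructure TateDual
  tateDual localTatePairingZMod unramifiedSubgroup mu MuCarrier)
open Literature.NumberTheory.GaloisCohomology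
open scoped ContRepresentation

namespace Summit.BirchSwinnertonDyer.BirchSwinnertonDyer.Theorems.InputsGreenbergCasselsTorsion

open Summit.BirchSwinnertonDyer.Rank1Residual.X11b.KummerPT
open Summit.BirchSwinnertonDyer.Rank1Residual.X11b.LocBridge
open Summit.BirchSwinnertonDyer.Rank1Residual.X11b.Levels
open Summit.BirchSwinnertonDyer.Rank1Residual.X11b.AcSelmer
open Summit.BirchSwinnertonDyer.Rank1Residual.X11b.FiniteDuality
open Summit.BirchSwinnertonDyer.Rank1Residual.X11b.Relaxation

variable {K : Type} [Field K] [NumberField K] (W : WeierstrassCurve K) [W.IsElliptic] (p k : ℕ)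
  [Fact p.Prime]

/-! ## §1 Poitou–Tate exactness for the Kummer structure, odd level, any number field -/

section LocalDual

variable (n : ℕ) [NeZero n]
variable (e : W.geomTorsion n → W.geomTorsion n → AlgebraicClosure K)
  (hμ : ∀ S T, e S T ^ n = 1)
  (hadd₁ : ∀ S₁ S₂ T, e (S₁ + S₂) T = e S₁ T * e S₂ T)
  (hadd₂ : ∀ S T₁ T₂, e S (T₁ + T₂) = e S T₁ * e S T₂)
  (hgal : ∀ (σ : absoluteGaloisGroup K) (S T : W.geomTorsion n), σ • e S T = e (σ • S) (σ • T))
  (halt : ∀ T, e T T = 1) (hnondeg : ∀ T, (∀ S, e S T = 1) → T = 0)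
  (inv : LocalInvariants K n)

include halt hnondeg in
/-- **The Weil transport of a dual Selmer class for `(kummerStrict S')^*` lies in `kummerOutside W n S'`, ODD `n`, ANY
number field** (`inv_v` injective and Tate's count at the finite `v ∉ S'`): at a finite `v ∉ S'` the dual condition
`𝓛_v^*` is transported into `𝓛_v` (`map_weilDualInv_mem_kummer_of_mem_dualLocalCondition`); at an infinite place every
class of `H¹(K_w, E[n])` vanishes because `n` is odd (`eq_zero_of_odd_nsmul_galoisCohomology_one_toLocal_inl`). Port of
`X11b.KummerPT.map_weilDualInv_mem_kummerOutside_of_mem_dualSelmerGroup` (there: all infinite places complex).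
[cite: MilneADT2006, Ch. I §6, proof of Prop. 6.9] [cite: SerreGaloisCohomology1997, I §2.4] -/
theorem map_weilDualInv_mem_kummerOutside_of_mem_dualSelmerGroup_of_odd [Finite (W.geomTorsion (n : ℤ))]
    (hn : Odd n) (S' : Finset (Place K))
    (hinv : ∀ v : HeightOneSpectrum (𝓞 K), (Sum.inr v : Place K) ∉ S' → Injective (inv (Sum.inr v)))
    (hEuler : ∀ v : HeightOneSpectrum (𝓞 K), (Sum.inr v : Place K) ∉ S' →
      Nat.card (galoisCohomology ((W.torsionGaloisModule n).toLocal (Sum.inr v)) 1) =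
        (Nat.card (nsmulAddMonoidHom n : (W.baseChange (v.adicCompletion K)).toAffine.Point →+ _).ker *
          Nat.card (v.adicCompletionIntegers K ⧸ Ideal.span {(n : v.adicCompletionIntegers K)})) ^ 2)
    {y : galoisCohomology ((W.torsionGaloisModule n).tateDual n) 1}
    (hy : y ∈ (inv.dualSelmerStructure (W.torsionGaloisModule n) (kummerStrict W n S')).selmerGroup) :
    galoisCohomology.map (weilDualInv W n e hμ hadd₁ hadd₂ hgal hnondeg) 1 y ∈ kummerOutside W n S' := by
  set yW := galoisCohomology.map (weilDualInv W n e hμ hadd₁ hadd₂ hgal hnondeg) 1 y with hyWdef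
  rw [mem_kummerOutside_iff]
  intro v hv
  have hyv := (SelmerStructure.mem_selmerGroup_iff _ y).mp hy v
  rw [LocalInvariants.dualSelmerStructure_apply, kummerStrict_of_not_mem W n S' hv] at hyv
  change galoisCohomology.localization (W.torsionGaloisModule (n : ℤ)) v 1 yW ∈
    W.kummerSelmerStructure (n : ℤ) v
  cases v with
  | inl w =>
    have hMn : ∀ m : W.geomTorsion (n : ℤ), n • m = 0 := fun m ↦ AddSubgroup.torsionBy.nsmul m
    have h0 : galoisCohomology.localization (W.torsionGaloisModule (n : ℤ)) (Sum.inl w) 1 yW = 0 :=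
      eq_zero_of_odd_nsmul_galoisCohomology_one_toLocal_inl (W.torsionGaloisModule (n : ℤ)) w hn _
        (galoisCohomology.nsmul_eq_zero_of_forall _ hMn _)
    rw [h0]
    exact zero_mem _
  | inr v =>
    rw [hyWdef, localization_map_one]
    exact map_weilDualInv_mem_kummer_of_mem_dualLocalCondition W n e hμ hadd₁ hadd₂ hgal halt hnondeg
      inv v (hinv v hv) (hEuler v hv) hyv

end LocalDual

section Exactness

variable (e : W.geomTorsion ((p ^ k : ℕ) : ℤ) → W.geomTorsion ((p ^ k : ℕ) : ℤ) → AlgebraicClosure K)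
  (hμ : ∀ S T, e S T ^ (p ^ k) = 1)
  (hadd₁ : ∀ S₁ S₂ T, e (S₁ + S₂) T = e S₁ T * e S₂ T)
  (hadd₂ : ∀ S T₁ T₂, e S (T₁ + T₂) = e S T₁ * e S T₂)
  (hgal : ∀ (σ : absoluteGaloisGroup K) (S T : W.geomTorsion ((p ^ k : ℕ) : ℤ)),
    σ • e S T = e (σ • S) (σ • T))
  (halt : ∀ T, e T T = 1) (hnondeg : ∀ T, (∀ S, e S T = 1) → T = 0)

include halt hnondeg in
/-- **Poitou–Tate exactness for the Kummer structure, ODD `p`, ANY number field** (Milne I Thm. 4.10 (b) `Ker γ¹ ⊆ Im β¹`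
at `⊕_{v∈S'} H¹(K_v, E[p^k])`, from Howard Thm. 2.1.11 `SelmerComplement`): if a family of local classes `t_v`
(`v ∈ S'`) satisfies `∑_{v∈S'} inv_v(t_v ∪ₑ loc_v c) = 0` for every `c ∈ kummerOutside W (p^k) S'`, then `t_v = loc_v x`
on `S'` for some `x ∈ kummerOutside W (p^k) S'`. Port of `X11b.KummerPT.exists_mem_kummerOutside_localization_eq`.
[cite: Howard2004HeegnerKolyvagin, Thm. 2.1.11 (arXiv:1202.6340 p. 6)] [cite: MilneADT2006, Ch. I, Thm. 4.10(b) and Lemma 6.15] -/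
theorem exists_mem_kummerOutside_localization_eq_of_odd (hp : Odd p)
    {inv : LocalInvariants K (p ^ k)} (hperf : inv.IsPerfect) (hcompl : inv.SelmerComplement)
    (hEuler : ∀ v : HeightOneSpectrum (𝓞 K),
      Nat.card (galoisCohomology ((W.torsionGaloisModule ((p ^ k : ℕ) : ℤ)).toLocal (Sum.inr v)) 1) =
        (Nat.card (nsmulAddMonoidHom (p ^ k) : (W.baseChange (v.adicCompletion K)).toAffine.Point →+ _).ker *
          Nat.card (v.adicCompletionIntegers K ⧸ Ideal.span {((p ^ k : ℕ) : v.adicCompletionIntegers K)})) ^ 2)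
    (S' : Finset (Place K))
    (t : Π v : Place K, galoisCohomology ((W.torsionGaloisModule ((p ^ k : ℕ) : ℤ)).toLocal v) 1)
    (ht : ∀ c ∈ kummerOutside W (p ^ k) S',
      ∑ v ∈ S', invWeilPairing W (p ^ k) e hμ hadd₁ hadd₂ hgal inv v (t v)
        (galoisCohomology.localization (W.torsionGaloisModule ((p ^ k : ℕ) : ℤ)) v 1 c) = 0) :
    ∃ x ∈ kummerOutside W (p ^ k) S', ∀ v ∈ S',
      galoisCohomology.localization (W.torsionGaloisModule ((p ^ k : ℕ) : ℤ)) v 1 x = t v := by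
  classical
  have hpk : Odd (p ^ k) := hp.pow
  have hprime : p.Prime := Fact.out
  haveI : NeZero (p ^ k) := ⟨pow_ne_zero k hprime.ne_zero⟩
  haveI : Finite (W.geomTorsion ((p ^ k : ℕ) : ℤ)) := finite_geomTorsion_of_neZero W _
  obtain ⟨T, hS'T, hinf, hpT, hbad⟩ := exists_exceptional_finset W p S'
  have hMn : ∀ m : W.geomTorsion ((p ^ k : ℕ) : ℤ), (p ^ k) • m = 0 := fun m ↦
    AddSubgroup.torsionBy.nsmul m
  have hTout : ∀ v : HeightOneSpectrum (𝓞 K), (Sum.inr v : Place K) ∉ T →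
      ((p ^ k : ℕ) : 𝓞 K) ∉ v.asIdeal ∧
        GaloisRep.IsUnramifiedAt v (W.torsionGaloisModule ((p ^ k : ℕ) : ℤ)) := by
    intro v hv
    have hpv : ((p : ℕ) : 𝓞 K) ∉ v.asIdeal := fun h ↦ hv (hpT v h)
    have hgood : W.HasGoodReductionAt v := by
      by_contra hbad'
      exact hv (hbad v hbad')
    exact ⟨natCast_pow_not_mem p hpv _,
      isUnramifiedAt_torsionGaloisModule W hgood (intCast_pow_not_mem p hpv _)⟩
  -- the test family, extended by zero off `S'`
  set t' : Π v : Place K, galoisCohomology ((W.torsionGaloisModule ((p ^ k : ℕ) : ℤ)).toLocal v) 1 :=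
    fun v ↦ if v ∈ S' then t v else 0 with ht'def
  have ht'mem : ∀ v ∈ S', t' v = t v := fun v hv ↦ by rw [ht'def]; exact if_pos hv
  have ht'not : ∀ v ∉ S', t' v = 0 := fun v hv ↦ by rw [ht'def]; exact if_neg hv
  have ht' : ∀ v ∈ T, t' v ∈ kummerRelaxed W (p ^ k) S' v := by
    intro v _
    by_cases hv : v ∈ S'
    · rw [kummerRelaxed_of_mem W (p ^ k) S' hv]; exact AddSubgroup.mem_top _
    · rw [ht'not v hv]; exact zero_mem _
  -- Poitou–Tate
  obtain ⟨x, hx, hxt⟩ := (hcompl (W.torsionGaloisModule ((p ^ k : ℕ) : ℤ)) hMn T hTout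
    (kummerStrict W (p ^ k) S') (kummerRelaxed W (p ^ k) S') (kummerStrict_le_kummerRelaxed W (p ^ k) S')
    (kummerStrict_isUnramifiedOutside W p k S' T hS'T hinf hpT hbad)
    (kummerRelaxed_isUnramifiedOutside W p k S' T hS'T hinf hpT hbad)).1 t' ht' (fun y hy ↦ by
      -- the obstruction vanishes
      set yW := galoisCohomology.map (weilDualInv W (p ^ k) e hμ hadd₁ hadd₂ hgal hnondeg) 1 y
        with hyWdef
      have hyW : galoisCohomology.map (weilDualIntertwining W (p ^ k) e hμ hadd₁ hadd₂ hgal) 1 yW = y :=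
        map_weilDual_map_weilDualInv W (p ^ k) e hμ hadd₁ hadd₂ hgal hnondeg y
      have hyKO : yW ∈ kummerOutside W (p ^ k) S' :=
        map_weilDualInv_mem_kummerOutside_of_mem_dualSelmerGroup_of_odd W (p ^ k) e hμ hadd₁ hadd₂ hgal halt
          hnondeg inv hpk S' (fun v _ ↦ (hperf v).1.1) (fun v _ ↦ hEuler v) hy
      have hterm : ∀ v : Place K,
          localTatePairingZMod (W.torsionGaloisModule ((p ^ k : ℕ) : ℤ)) (p ^ k) v (inv v) (t' v)
            (galoisCohomology.localization
              ((W.torsionGaloisModule ((p ^ k : ℕ) : ℤ)).tateDual (p ^ k)) v 1 y) =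
          invWeilPairing W (p ^ k) e hμ hadd₁ hadd₂ hgal inv v (t' v)
            (galoisCohomology.localization (W.torsionGaloisModule ((p ^ k : ℕ) : ℤ)) v 1 yW) := by
        intro v
        rw [← hyW, localization_map_one, localTatePairingZMod_map_weilDual, invWeilPairing_apply]
      calc ∑ v ∈ T, localTatePairingZMod (W.torsionGaloisModule ((p ^ k : ℕ) : ℤ)) (p ^ k) v (inv v)
              (t' v) (galoisCohomology.localization
                ((W.torsionGaloisModule ((p ^ k : ℕ) : ℤ)).tateDual (p ^ k)) v 1 y)
          = ∑ v ∈ T, invWeilPairing W (p ^ k) e hμ hadd₁ hadd₂ hgal inv v (t' v)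
              (galoisCohomology.localization (W.torsionGaloisModule ((p ^ k : ℕ) : ℤ)) v 1 yW) :=
            Finset.sum_congr rfl fun v _ ↦ hterm v
        _ = ∑ v ∈ S', invWeilPairing W (p ^ k) e hμ hadd₁ hadd₂ hgal inv v (t' v)
              (galoisCohomology.localization (W.torsionGaloisModule ((p ^ k : ℕ) : ℤ)) v 1 yW) := by
            refine (Finset.sum_subset hS'T fun v _ hvS' ↦ ?_).symm
            rw [ht'not v hvS', map_zero, AddMonoidHom.zero_apply]
        _ = ∑ v ∈ S', invWeilPairing W (p ^ k) e hμ hadd₁ hadd₂ hgal inv v (t v)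
              (galoisCohomology.localization (W.torsionGaloisModule ((p ^ k : ℕ) : ℤ)) v 1 yW) :=
            Finset.sum_congr rfl fun v hv ↦ by rw [ht'mem v hv]
        _ = 0 := ht yW hyKO)
  refine ⟨x, ?_, fun v hv ↦ ?_⟩
  · rw [← selmerGroup_kummerRelaxed W (p ^ k) S']
    exact hx
  · have h := hxt v (hS'T hv)
    rw [kummerStrict_of_mem W (p ^ k) S' hv, AddSubgroup.mem_bot, sub_eq_zero, ht'mem v hv] at h
    exact h

/-! ## §2 The exact relaxation index at one finite place, odd level -/

variable (𝔮 : HeightOneSpectrum (𝓞 K))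

include halt hnondeg in
/-- **`loc_𝔮(kummerOutside W (p^k) {𝔮})` is its own annihilator in `H¹(K_𝔮, E[p^k])`**, ODD `p`, any number field
(port of `X11b.KummerPT.forall_mem_map_kummerOutside_iff`). [cite: MilneADT2006, Ch. I, Thm. 4.10(b)]
[cite: Howard2004HeegnerKolyvagin, Thm. 2.1.11 (arXiv:1202.6340 p. 6)] -/
theorem forall_mem_map_kummerOutside_iff_of_odd (hp : Odd p)
    {inv : LocalInvariants K (p ^ k)} (hperf : inv.IsPerfect) (hsum : inv.SumLocalTermEqZero)
    (hcompl : inv.SelmerComplement)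
    (hEuler : ∀ v : HeightOneSpectrum (𝓞 K),
      Nat.card (galoisCohomology ((W.torsionGaloisModule ((p ^ k : ℕ) : ℤ)).toLocal (Sum.inr v)) 1) =
        (Nat.card (nsmulAddMonoidHom (p ^ k) : (W.baseChange (v.adicCompletion K)).toAffine.Point →+ _).ker *
          Nat.card (v.adicCompletionIntegers K ⧸ Ideal.span {((p ^ k : ℕ) : v.adicCompletionIntegers K)})) ^ 2)
    (t : galoisCohomology ((W.torsionGaloisModule ((p ^ k : ℕ) : ℤ)).toLocal (Sum.inr 𝔮)) 1) :
    (∀ g ∈ (kummerOutside W (p ^ k) {Sum.inr 𝔮}).map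
        (galoisCohomology.localization (W.torsionGaloisModule ((p ^ k : ℕ) : ℤ)) (Sum.inr 𝔮) 1),
      invWeilPairing W (p ^ k) e hμ hadd₁ hadd₂ hgal inv (Sum.inr 𝔮) t g = 0) ↔
    t ∈ (kummerOutside W (p ^ k) {Sum.inr 𝔮}).map
        (galoisCohomology.localization (W.torsionGaloisModule ((p ^ k : ℕ) : ℤ)) (Sum.inr 𝔮) 1) := by
  classical
  constructor
  · intro h
    set tfam : Π v : Place K, galoisCohomology ((W.torsionGaloisModule ((p ^ k : ℕ) : ℤ)).toLocal v) 1 :=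
      Pi.single (Sum.inr 𝔮) t with htfam
    obtain ⟨x, hx, hxt⟩ := exists_mem_kummerOutside_localization_eq_of_odd W p k e hμ hadd₁ hadd₂ hgal halt
      hnondeg hp hperf hcompl hEuler {Sum.inr 𝔮} tfam (fun c hc ↦ by
        rw [Finset.sum_singleton, htfam, Pi.single_eq_same]
        exact h _ ⟨c, hc, rfl⟩)
    refine ⟨x, hx, ?_⟩
    rw [hxt _ (Finset.mem_singleton_self _), htfam, Pi.single_eq_same]
  · rintro ⟨x, hx, rfl⟩ g ⟨c, hc, rfl⟩
    have h := sum_invWeilPairing_localization_eq_zero_of_mem_kummerOutside W (p ^ k) e hμ hadd₁ hadd₂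
      hgal halt inv hsum {Sum.inr 𝔮} hx hc
    rwa [Finset.sum_singleton] at h

include halt hnondeg in
/-- **Milne I Lemma 6.15 at the single place `𝔮`, subgroup form, ODD `p`, any number field:
`{}^⊥(G ⊓ 𝓛_𝔮) = G ⊔ 𝓛_𝔮`** for `G = loc_𝔮(kummerOutside W (p^k) {𝔮})` (port of `X11b.KummerPT.annLeft_inf_eq_sup`).
[cite: MilneADT2006, Ch. I, Lemma 6.15] -/
theorem annLeft_inf_eq_sup_of_odd (hp : Odd p)
    {inv : LocalInvariants K (p ^ k)} (hperf : inv.IsPerfect) (hsum : inv.SumLocalTermEqZero)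
    (hcompl : inv.SelmerComplement)
    (hEuler : ∀ v : HeightOneSpectrum (𝓞 K),
      Nat.card (galoisCohomology ((W.torsionGaloisModule ((p ^ k : ℕ) : ℤ)).toLocal (Sum.inr v)) 1) =
        (Nat.card (nsmulAddMonoidHom (p ^ k) : (W.baseChange (v.adicCompletion K)).toAffine.Point →+ _).ker *
          Nat.card (v.adicCompletionIntegers K ⧸ Ideal.span {((p ^ k : ℕ) : v.adicCompletionIntegers K)})) ^ 2) :
    annLeft (invWeilPairing W (p ^ k) e hμ hadd₁ hadd₂ hgal inv (Sum.inr 𝔮))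
        ((kummerOutside W (p ^ k) {Sum.inr 𝔮}).map
            (galoisCohomology.localization (W.torsionGaloisModule ((p ^ k : ℕ) : ℤ)) (Sum.inr 𝔮) 1) ⊓
          W.kummerSelmerStructure ((p ^ k : ℕ) : ℤ) (Sum.inr 𝔮)) =
      (kummerOutside W (p ^ k) {Sum.inr 𝔮}).map
          (galoisCohomology.localization (W.torsionGaloisModule ((p ^ k : ℕ) : ℤ)) (Sum.inr 𝔮) 1) ⊔
        W.kummerSelmerStructure ((p ^ k : ℕ) : ℤ) (Sum.inr 𝔮) := by
  haveI := finite_galoisCohomology_toLocal_inr W (p ^ k) 𝔮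
  have hA := nsmul_galoisCohomology_toLocal_eq_zero W (p ^ k) (Sum.inr 𝔮)
  have hbij := invWeilPairing_bijective W (p ^ k) e hμ hadd₁ hadd₂ hgal hnondeg inv 𝔮 (hperf 𝔮).1.1
  ext t
  rw [mem_annLeft_iff, AddSubgroup.mem_sup]
  rw [forall_mem_inf_iff_exists_add_of_self_annihilating
    (invWeilPairing W (p ^ k) e hμ hadd₁ hadd₂ hgal inv (Sum.inr 𝔮)) hA hbij.1 _ _
    (forall_mem_map_kummerOutside_iff_of_odd W p k e hμ hadd₁ hadd₂ hgal halt hnondeg 𝔮 hp hperf hsum hcompl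
      hEuler)
    (forall_mem_kummer_invWeilPairing_eq_zero_iff W p k e hμ hadd₁ hadd₂ hgal halt hnondeg 𝔮
      (hperf 𝔮).1.1 (hEuler 𝔮)) t]

include e hμ hadd₁ hadd₂ hgal halt hnondeg in
/-- **THE EXACT RELAXATION INDEX, ODD `p`, ANY NUMBER FIELD** (port of
`X11b.KummerPT.relIndex_selmerGroup_kummerOutside_mul_natCard_map_eq`): for a Poitou–Tate family `inv` at level `p^k`
and Tate's count at every finite place, `[kummerOutside W (p^k) {𝔮} : Sel_{p^k}(E/K)] · #loc_𝔮(Sel_{p^k}(E/K)) = #𝓛_𝔮`.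
[cite: GreenbergLNM1716, §4 Appendix Prop. 4.13 (pp. 121–122)] [cite: JetchevSkinnerWan2017, Prop. 3.2.1]
[cite: MilneADT2006, Ch. I, Thm. 4.10(b), Cor. 2.3 and Lemma 6.15] -/
theorem relIndex_selmerGroup_kummerOutside_mul_natCard_map_eq_of_odd (hp : Odd p)
    {inv : LocalInvariants K (p ^ k)} (hperf : inv.IsPerfect) (hsum : inv.SumLocalTermEqZero)
    (hcompl : inv.SelmerComplement)
    (hEuler : ∀ v : HeightOneSpectrum (𝓞 K),
      Nat.card (galoisCohomology ((W.torsionGaloisModule ((p ^ k : ℕ) : ℤ)).toLocal (Sum.inr v)) 1) =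
        (Nat.card (nsmulAddMonoidHom (p ^ k) : (W.baseChange (v.adicCompletion K)).toAffine.Point →+ _).ker *
          Nat.card (v.adicCompletionIntegers K ⧸ Ideal.span {((p ^ k : ℕ) : v.adicCompletionIntegers K)})) ^ 2) :
    (W.selmerGroup ((p ^ k : ℕ) : ℤ)).relIndex (kummerOutside W (p ^ k) {Sum.inr 𝔮}) *
        Nat.card ((W.selmerGroup ((p ^ k : ℕ) : ℤ)).map
          (galoisCohomology.localization (W.torsionGaloisModule ((p ^ k : ℕ) : ℤ)) (Sum.inr 𝔮) 1)) =
      Nat.card (W.kummerSelmerStructure ((p ^ k : ℕ) : ℤ) (Sum.inr 𝔮)) := by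
  haveI hfin := finite_galoisCohomology_toLocal_inr W (p ^ k) 𝔮
  set loc := galoisCohomology.localization (W.torsionGaloisModule ((p ^ k : ℕ) : ℤ)) (Sum.inr 𝔮) 1
    with hloc
  set b := invWeilPairing W (p ^ k) e hμ hadd₁ hadd₂ hgal inv (Sum.inr 𝔮) with hb
  set L := W.kummerSelmerStructure ((p ^ k : ℕ) : ℤ) (Sum.inr 𝔮) with hL
  set KO := kummerOutside W (p ^ k) {Sum.inr 𝔮} with hKO
  set G := KO.map loc with hG
  set Sel := W.selmerGroup ((p ^ k : ℕ) : ℤ) with hSel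
  have hA := nsmul_galoisCohomology_toLocal_eq_zero W (p ^ k) (Sum.inr 𝔮)
  have hbij : Bijective b :=
    invWeilPairing_bijective W (p ^ k) e hμ hadd₁ hadd₂ hgal hnondeg inv 𝔮 (hperf 𝔮).1.1
  -- (1) `[KO : Sel] = [L ⊔ G : L]`
  have h1' : (L.comap loc ⊓ KO).relIndex KO = L.relIndex (L ⊔ G) := by
    rw [AddSubgroup.inf_relIndex_right, AddSubgroup.relIndex_comap, AddSubgroup.relIndex_sup_left]
  have h1 : Sel.relIndex KO = L.relIndex (L ⊔ G) := by
    rw [hSel, selmerGroup_eq_comap_inf_kummerOutside W p k 𝔮]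
    exact h1'
  -- (2) `loc Sel = G ⊓ L`
  have h2 : Sel.map loc = G ⊓ L := map_selmerGroup_eq_inf W p k 𝔮
  -- (3) `G ⊔ L = annLeft b (G ⊓ L)` and `#annLeft(G ⊓ L) · #(G ⊓ L) = #H¹`
  have h3 : annLeft b (G ⊓ L) = G ⊔ L :=
    annLeft_inf_eq_sup_of_odd W p k e hμ hadd₁ hadd₂ hgal halt hnondeg 𝔮 hp hperf hsum hcompl hEuler
  have h4 : Nat.card (annLeft b (G ⊓ L)) * Nat.card ↥(G ⊓ L) =
      Nat.card (galoisCohomology ((W.torsionGaloisModule ((p ^ k : ℕ) : ℤ)).toLocal (Sum.inr 𝔮)) 1) :=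
    natCard_annLeft_mul hA b hbij (G ⊓ L)
  -- (4) `#H¹ = #L · #L`
  have hLcard : Nat.card L = Nat.card (nsmulAddMonoidHom (p ^ k) :
        (W.baseChange (𝔮.adicCompletion K)).toAffine.Point →+ _).ker *
      Nat.card (𝔮.adicCompletionIntegers K ⧸ Ideal.span {((p ^ k : ℕ) : 𝔮.adicCompletionIntegers K)}) :=
    W.natCard_kummerSelmerStructure_inr 𝔮 (NeZero.ne (p ^ k))
  have h5 : Nat.card (galoisCohomology ((W.torsionGaloisModule ((p ^ k : ℕ) : ℤ)).toLocal (Sum.inr 𝔮)) 1) =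
      Nat.card L * Nat.card L := by
    rw [hEuler 𝔮, hLcard, sq]
  -- (5) `[L ⊔ G : L] · #L = #(L ⊔ G)`
  have h6 : L.relIndex (L ⊔ G) * Nat.card L = Nat.card ↥(L ⊔ G) := by
    rw [AddSubgroup.relIndex, mul_comm,
      ← Nat.card_congr (AddSubgroup.addSubgroupOfEquivOfLe (le_sup_left : L ≤ L ⊔ G)).toEquiv]
    exact AddSubgroup.card_mul_index _
  have hLpos : 0 < Nat.card L := Nat.card_pos
  apply Nat.eq_of_mul_eq_mul_right hLpos
  rw [h1, h2]
  calc L.relIndex (L ⊔ G) * Nat.card ↥(G ⊓ L) * Nat.card L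
      = L.relIndex (L ⊔ G) * Nat.card L * Nat.card ↥(G ⊓ L) := by ring
    _ = Nat.card ↥(L ⊔ G) * Nat.card ↥(G ⊓ L) := by rw [h6]
    _ = Nat.card (annLeft b (G ⊓ L)) * Nat.card ↥(G ⊓ L) := by rw [h3, sup_comm]
    _ = Nat.card L * Nat.card L := by rw [h4, h5]

end Exactness

/-! ## §3 Unconditional: Poitou–Tate and Tate's count are tree theorems -/

/-- **THE EXACT RELAXATION INDEX AT ONE FINITE PLACE, ODD `p`, EVERY NUMBER FIELD — UNCONDITIONAL**: for `E = W` elliptic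
over a number field `K` (real places allowed), an odd prime `p`, `k ≥ 1` and ANY finite place `𝔮`,
`[kummerOutside W (p^k) {𝔮} : Sel_{p^k}(E/K)] · #loc_𝔮(Sel_{p^k}(E/K)) = #E(K_𝔮)[p^k] · #(𝓞_𝔮/p^k)` (`= #𝓛_𝔮`). The
Poitou–Tate family is `SchneiderFreeAdditiveX3.PoitouTateReduction.poitouTate_selmerStructure_duality_holds K`, Tate's
count is `natCard_galoisCohomology_one_torsion_adicCompletion_eq_sqEP`, the Weil pairing is `exists_weilPairing_holds`.
This is the finite-level body of Cassels' theorem (Greenberg Prop. 4.13): the cokernel of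
`H¹_{𝓛, ⊤ at 𝔮}(K, E[p^k]) → H¹(K_𝔮, E[p^k])/𝓛_𝔮` has order `#loc_𝔮(Sel_{p^k}(E/K))`.
[cite: GreenbergLNM1716, §4 p. 104 and Appendix Prop. 4.13 (pp. 121–122)] [cite: MilneADT2006, Ch. I, Thm. 2.8, Thm. 4.10(b), Lemma 6.15] -/
theorem relIndex_selmerGroup_kummerOutside_mul_natCard_map_eq_odd (hp : Odd p) (hk : 0 < k)
    (𝔮 : HeightOneSpectrum (𝓞 K)) :
    (W.selmerGroup ((p ^ k : ℕ) : ℤ)).relIndex (kummerOutside W (p ^ k) {Sum.inr 𝔮}) *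
        Nat.card ((W.selmerGroup ((p ^ k : ℕ) : ℤ)).map
          (galoisCohomology.localization (W.torsionGaloisModule ((p ^ k : ℕ) : ℤ)) (Sum.inr 𝔮) 1)) =
      Nat.card (nsmulAddMonoidHom (p ^ k) :
          (W.baseChange (𝔮.adicCompletion K)).toAffine.Point →+ _).ker *
        Nat.card (𝔮.adicCompletionIntegers K ⧸ Ideal.span {((p ^ k : ℕ) : 𝔮.adicCompletionIntegers K)}) := by
  have hprime : p.Prime := Fact.out
  have hpp : IsPrimePow (p ^ k) := ⟨p, k, hprime.prime, hk, rfl⟩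
  have hp2 : 2 ≤ p ^ k := le_trans hprime.two_le (Nat.le_self_pow hk.ne' p)
  have hchar : ((p ^ k : ℕ) : K) ≠ 0 := Nat.cast_ne_zero.mpr (pow_ne_zero _ hprime.ne_zero)
  obtain ⟨e, hμ, hadd₁, hadd₂, halt, hnondeg, hgal⟩ := W.exists_weilPairing_holds (p ^ k) hp2 hchar
  obtain ⟨inv, hperf, hsum, -, hcompl⟩ :=
    SchneiderFreeAdditiveX3.PoitouTateReduction.poitouTate_selmerStructure_duality_holds K (p ^ k)
  have hEuler : ∀ v : HeightOneSpectrum (𝓞 K),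
      Nat.card (galoisCohomology ((W.torsionGaloisModule ((p ^ k : ℕ) : ℤ)).toLocal (Sum.inr v)) 1) =
        (Nat.card (nsmulAddMonoidHom (p ^ k) : (W.baseChange (v.adicCompletion K)).toAffine.Point →+ _).ker *
          Nat.card (v.adicCompletionIntegers K ⧸
            Ideal.span {((p ^ k : ℕ) : v.adicCompletionIntegers K)})) ^ 2 := fun v ↦
    natCard_galoisCohomology_one_torsion_adicCompletion_eq_sqEP W v (p ^ k) hpp
  rw [relIndex_selmerGroup_kummerOutside_mul_natCard_map_eq_of_odd W p k e hμ hadd₁ hadd₂ hgal halt hnondeg 𝔮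
    hp hperf hsum hcompl hEuler]
  exact W.natCard_kummerSelmerStructure_inr 𝔮 (NeZero.ne (p ^ k))

end Summit.BirchSwinnertonDyer.BirchSwinnertonDyer.Theorems.InputsGreenbergCasselsTorsion

end
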